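import Mathlib
import HarnessLib.Audit
import Summits.PneNP.PneNP.Theorems.PstarGateCaseTTouch
import Summits.PneNP.PneNP.Theorems.PstarGateSharedEdge
import Summits.PneNP.PneNP.Theorems.PstarGateCasePNorHolders
import Summits.PneNP.PneNP.Theorems.PstarNorUnitBridge

/-!
# One GATED chord, CASE T: the PAIR BUDGET — every other chord is coupled to the gated one, or exceptional (E2; prover-1 g19)

FRONTIER range-avoidance ladder, rung F-N3 (`stmt-PneNP-19007`), cell `pnp-ideate` (`PstarGateNodesX`, nodes N3/N4); restricted-model proof
complexity — nothing here bears on `P` versus `NP`.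

CASE T, another chord `e'`.  Boundary count on the SUB-family `X = C_e ∪ C_{e'} ∪ {g₀}` (XOR vertices of the two cycles are inner; `e` pays `≤ 1`,
`e'` pays `2`, `g₀` pays `≤ 2` when some edge of `D e ∪ D e'` passes through `u` and `≤ 3` otherwise; a tree edge pays `≤ 2`, and `≤ 1` as soon as
one of its AND variables is read by another member of `X` — by `PstarGateCaseTTouch` an `X`-private tree edge lies on BOTH fundamental sets):

* `caseT_pair_budget` — **`#(D e ∪ D e') ≤ 1 + 2·#Pv` (resp. `≤ 3 + 2·#Pv` without a `u`-edge)**, `Pv` = the `X`-private edges of `D e ∩ D e'`;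
* `caseT_pair_coupled` — **hence, if some edge of `D e ∪ D e'` passes through `u` or `#(D e ∪ D e') ≥ 4`, the chord `e'` is COUPLED:
  `u_{e'} = u_e + 1` on the gate chamber** (`PstarGateSharedEdge.coupled_of_private_shared`).
-/

set_option linter.dupNamespace false -- `Summit.PneNP.PneNP.…`: summit = sub-problem name (D-0017 single-conjunct layout)

open Finset Literature.Computability.Complexity
open Summit.PneNP.PneNP.Theorems.PstarTyped (Typed)
open Summit.PneNP.PneNP.Theorems.PstarSALevel (varSet bdry BoundaryExpanding SimpleOverlap)
open Summit.PneNP.PneNP.Theorems.PstarGapLinearised (andPair andPair_subset_varSet)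
open Summit.PneNP.PneNP.Theorems.PstarCentreFree (vars_mem_varSet)
open Summit.PneNP.PneNP.Theorems.PstarXCore (xpair xverts mem_xpair)
open Summit.PneNP.PneNP.Theorems.PstarReadSumset (V2)
open Summit.PneNP.PneNP.Theorems.PstarChordSystem (ChordSystem)
open Summit.PneNP.PneNP.Theorems.PstarChordBridgeTools (privs coef xpdeg)
open Summit.PneNP.PneNP.Theorems.PstarChordBridge (BridgeData sys)
open Summit.PneNP.PneNP.Theorems.PstarChordBridgeFundamental (odd_of_end)
open Summit.PneNP.PneNP.Theorems.PstarChordBridgeCotree (mem_xverts_iff_xpdeg_pos)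
open Summit.PneNP.PneNP.Theorems.PstarNorCoreTools (not_mem_bdry_of_two card_varSet_inter_bdry_le card_bdry_le_sum)
open Summit.PneNP.PneNP.Theorems.PstarNorUnitBridge (xor_not_mem_bdry_of_even)
open Summit.PneNP.PneNP.Theorems.PstarGateBridge (GateHyp)
open Summit.PneNP.PneNP.Theorems.PstarGateCasePNorHolders (not_mem_bdry_sup card_three_slots)
open Summit.PneNP.PneNP.Theorems.PstarGateNodes (GateData)
open Summit.PneNP.PneNP.Theorems.PstarGateNodesX (GateDataX)
open Summit.PneNP.PneNP.Theorems.PstarGateCaseTTouch (caseT_force caseT_touch caseT_touch')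
open Summit.PneNP.PneNP.Theorems.PstarGateSharedEdge (coupled_of_private_shared)

namespace Summit.PneNP.PneNP.Theorems.PstarGateCaseTPair

variable {n m : ℕ}

/-- The endpoints of a chord are XOR vertices of its fundamental set. -/
theorem xpair_subset_xverts_D (I : LocalMap 4 n m) (hI : I.IsPure xorAndPred) {B : BridgeData n m} (hW : B.WF I) {c : Fin m} (hc : c ∈ B.N) :
    xpair I c ⊆ xverts I (B.D c) := by
  intro w hw
  have hcD : c ∉ B.D c := fun h => (mem_sdiff.1 (hW.hD c hc h)).2 hc
  refine (mem_xverts_iff_xpdeg_pos I _ w).2 ?_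
  rcases (mem_xpair I).1 hw with rfl | rfl
  · exact (odd_of_end I hI hcD (hW.hDeven c hc) (s := 0) (by decide)).pos
  · exact (odd_of_end I hI hcD (hW.hDeven c hc) (s := 1) (by decide)).pos

section Pair

variable (I : LocalMap 4 n m) (hI : I.IsPure xorAndPred) (hT : Typed I) (hS : SimpleOverlap I) {r₀ : ℕ} (hB : BoundaryExpanding r₀ I)
  {B : BridgeData n m} {e g₀ : Fin m} {u : Fin n} {κ₀ : ZMod 2} (hD : GateDataX I r₀ B e g₀ u κ₀) {mv : V2} (hmvT : mv = (0, 1) ∨ mv = (1, 1))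
  {e' : Fin m} (he' : e' ∈ B.N) (hne : e' ≠ e)
  (hP : ∀ a, ((sys I B).ρ e' a = 0 ∨ (sys I B).ρ e' a = mv) ∧ ((sys I B).ρ' e' a = 0 ∨ (sys I B).ρ' e' a = mv))
  (hread : ∀ a, (sys I B).ρ e' a ≠ 0 ∨ (sys I B).ρ' e' a ≠ 0)
include hI hT hS hB hD hmvT he' hne hP hread

/-- **The pair budget.**  See the module docstring. -/
theorem caseT_pair_budget :
    ∃ Pv ⊆ B.D e ∩ B.D e',
      (∀ j ∈ Pv, ∀ j' ∈ insert g₀ (insert e (insert e' (B.D e ∪ B.D e'))), j' ≠ j → I.vars j 2 ∉ varSet I j' ∧ I.vars j 3 ∉ varSet I j') ∧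
      (∀ j ∈ B.D e ∩ B.D e',
        (∀ j' ∈ insert g₀ (insert e (insert e' (B.D e ∪ B.D e'))), j' ≠ j → I.vars j 2 ∉ varSet I j' ∧ I.vars j 3 ∉ varSet I j') → j ∈ Pv) ∧
      ((∃ j ∈ B.D e ∪ B.D e', I.vars j 2 = u ∨ I.vars j 3 = u) → (B.D e ∪ B.D e').card ≤ 1 + 2 * Pv.card) ∧
      (B.D e ∪ B.D e').card ≤ 3 + 2 * Pv.card := by
  classical
  obtain ⟨-, hW, hr, hd₁, -, -, -, -, hG, hg₀, hgv, -⟩ := id hD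
  have he : e ∈ B.N := hG.1
  have heJ : e ∈ B.J₀ := hW.hN he
  have he'J : e' ∈ B.J₀ := hW.hN he'
  have hg₀J : g₀ ∉ B.J₀ := fun h => disjoint_left.1 hd₁ hg₀ h
  set U := B.D e ∪ B.D e' with hUdef
  have hUF : U ⊆ B.J₀ \ B.N := union_subset (hW.hD e he) (hW.hD e' he')
  have hUJ : U ⊆ B.J₀ := hUF.trans sdiff_subset
  set X : Finset (Fin m) := insert g₀ (insert e (insert e' U)) with hXdef
  set Pv := (B.D e ∩ B.D e').filter (fun j => ∀ j' ∈ X, j' ≠ j → I.vars j 2 ∉ varSet I j' ∧ I.vars j 3 ∉ varSet I j') with hPv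
  have heU : e ∉ U := fun h => (mem_sdiff.1 (hUF h)).2 he
  have he'U : e' ∉ U := fun h => (mem_sdiff.1 (hUF h)).2 he'
  have hee' : e ≠ e' := Ne.symm hne
  have he'X' : e ∉ insert e' U := by rw [mem_insert, not_or]; exact ⟨hee', heU⟩
  have hg₀X' : g₀ ∉ insert e (insert e' U) := by
    rw [mem_insert, mem_insert, not_or, not_or]
    exact ⟨fun h => hg₀J (h ▸ heJ), fun h => hg₀J (h ▸ he'J), fun h => hg₀J (hUJ h)⟩
  have hXcard : X.card = U.card + 3 := by
    rw [hXdef, card_insert_of_notMem hg₀X', card_insert_of_notMem he'X', card_insert_of_notMem he'U]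
  have hXsub : X ⊆ B.J₀ ∪ B.G₁ ∪ B.G₂ :=
    insert_subset (mem_union_left _ (mem_union_right _ hg₀))
      (insert_subset (mem_union_left _ (mem_union_left _ heJ)) (insert_subset (mem_union_left _ (mem_union_left _ he'J))
        (hUJ.trans (subset_union_left.trans subset_union_left))))
  have hXr : X.card ≤ r₀ := (card_le_card hXsub).trans hr
  have hg₀X : g₀ ∈ X := mem_insert_self _ _
  have heX : e ∈ X := mem_insert_of_mem (mem_insert_self _ _)
  have he'X : e' ∈ X := mem_insert_of_mem (mem_insert_of_mem (mem_insert_self _ _))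
  have hUX : U ⊆ X := fun j hj => mem_insert_of_mem (mem_insert_of_mem (mem_insert_of_mem hj))
  have hp_g₀ : I.vars e 2 ∈ varSet I g₀ := by
    rcases hgv with ⟨h2, -⟩ | ⟨-, h3⟩
    · exact h2 ▸ vars_mem_varSet I g₀ 2
    · exact h3 ▸ vars_mem_varSet I g₀ 3
  have hu_g₀ : u ∈ varSet I g₀ := by
    rcases hgv with ⟨-, h3⟩ | ⟨h2, -⟩
    · exact h3 ▸ vars_mem_varSet I g₀ 3
    · exact h2 ▸ vars_mem_varSet I g₀ 2
  refine ⟨Pv, filter_subset _ _, fun j hj => (mem_filter.1 hj).2, fun j hj hp => mem_filter.2 ⟨hj, hp⟩, ?_⟩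
  -- XOR slots of the two cycles are inner
  have hDsubX : insert e (B.D e) ⊆ X := insert_subset heX (subset_union_left.trans hUX)
  have hD'subX : insert e' (B.D e') ⊆ X := insert_subset he'X (subset_union_right.trans hUX)
  have hxorD : ∀ j ∈ insert e (B.D e), ∀ s : Fin 4, s.val < 2 → I.vars j s ∉ bdry I X := fun j hj s hs =>
    not_mem_bdry_sup I hDsubX hj (vars_mem_varSet I j s) (xor_not_mem_bdry_of_even I hI (hW.hDeven e he) j hj s hs)
  have hxorD' : ∀ j ∈ insert e' (B.D e'), ∀ s : Fin 4, s.val < 2 → I.vars j s ∉ bdry I X := fun j hj s hs =>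
    not_mem_bdry_sup I hD'subX hj (vars_mem_varSet I j s) (xor_not_mem_bdry_of_even I hI (hW.hDeven e' he') j hj s hs)
  have hxor : ∀ j ∈ X, j ≠ g₀ → ∀ s : Fin 4, s.val < 2 → I.vars j s ∉ bdry I X := by
    intro j hj hjg s hs
    rw [hXdef, mem_insert, mem_insert, mem_insert] at hj
    rcases hj with h | h | h | h
    · exact absurd h hjg
    · exact hxorD j (h ▸ mem_insert_self _ _) s hs
    · exact hxorD' j (h ▸ mem_insert_self _ _) s hs
    · rcases mem_union.1 h with h | h
      · exact hxorD j (mem_insert_of_mem h) s hs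
      · exact hxorD' j (mem_insert_of_mem h) s hs
  -- the `u` indicator
  set δ : ℕ := if ∃ j ∈ U, I.vars j 2 = u ∨ I.vars j 3 = u then 0 else 1 with hδ
  -- per-output budgets
  let q : Fin m → ℕ := fun k => if k = g₀ then 2 + δ else if k = e' then 2 else if k ∈ Pv then 2 else 1
  have hq : ∀ k ∈ X, (varSet I k ∩ bdry I X).card ≤ q k := by
    intro k hk
    by_cases hkg₀ : k = g₀
    · subst hkg₀
      simp only [q, if_true]
      by_cases hU : ∃ j ∈ U, I.vars j 2 = u ∨ I.vars j 3 = u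
      · have hδ0 : δ = 0 := by rw [hδ, if_pos hU]
        rw [hδ0, add_zero]
        obtain ⟨jᵤ, hjᵤU, hjᵤu⟩ := hU
        have hu_jᵤ : u ∈ varSet I jᵤ := by rcases hjᵤu with h | h <;> rw [← h] <;> exact vars_mem_varSet I jᵤ _
        have hjᵤk : jᵤ ≠ k := fun h => hg₀J (h ▸ hUJ hjᵤU)
        have h := card_varSet_inter_bdry_le I X k {2, 3} (fun s hs => by
          simp only [mem_insert, mem_singleton] at hs
          rcases hs with rfl | rfl
          · rcases hgv with ⟨h2, -⟩ | ⟨h2, -⟩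
            · exact not_mem_bdry_of_two I hk heX (fun h => hg₀J (h ▸ heJ)) (vars_mem_varSet I k 2) (h2 ▸ vars_mem_varSet I e 2)
            · exact not_mem_bdry_of_two I hk (hUX hjᵤU) hjᵤk.symm (vars_mem_varSet I k 2) (h2 ▸ hu_jᵤ)
          · rcases hgv with ⟨-, h3⟩ | ⟨-, h3⟩
            · exact not_mem_bdry_of_two I hk (hUX hjᵤU) hjᵤk.symm (vars_mem_varSet I k 3) (h3 ▸ hu_jᵤ)
            · exact not_mem_bdry_of_two I hk heX (fun h => hg₀J (h ▸ heJ)) (vars_mem_varSet I k 3) (h3 ▸ vars_mem_varSet I e 2))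
        have h2 : ({2, 3} : Finset (Fin 4)).card = 2 := by decide
        rw [h2] at h; exact h
      · have hδ1 : δ = 1 := by rw [hδ, if_neg hU]
        rw [hδ1]
        obtain ⟨s, hs2, hps⟩ : ∃ s : Fin 4, 2 ≤ s.val ∧ I.vars k s = I.vars e 2 := by
          rcases hgv with ⟨h2, -⟩ | ⟨-, h3⟩
          · exact ⟨2, by decide, h2⟩
          · exact ⟨3, by decide, h3⟩
        have h := card_varSet_inter_bdry_le I X k {s} (fun s' hs' => by
          rw [mem_singleton] at hs'
          subst hs'
          exact not_mem_bdry_of_two I hk heX (fun h => hg₀J (h ▸ heJ)) (vars_mem_varSet I k s') (hps ▸ vars_mem_varSet I e 2))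
        rw [card_singleton] at h
        exact h
    have hkJ : k ∈ B.J₀ := by
      rw [hXdef, mem_insert] at hk
      rcases hk with h | h
      · exact absurd h hkg₀
      rw [mem_insert] at h
      rcases h with h | h
      · exact h ▸ heJ
      rw [mem_insert] at h
      rcases h with h | h
      · exact h ▸ he'J
      · exact hUJ h
    have htwo : (varSet I k ∩ bdry I X).card ≤ 2 := by
      have h := card_varSet_inter_bdry_le I X k {0, 1} (fun s hs => by
        simp only [mem_insert, mem_singleton] at hs
        rcases hs with rfl | rfl
        · exact hxor k hk hkg₀ 0 (by decide)
        · exact hxor k hk hkg₀ 1 (by decide))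
      have h2 : ({0, 1} : Finset (Fin 4)).card = 2 := by decide
      rw [h2] at h; exact h
    by_cases hke' : k = e'
    · have hq' : q k = 2 := by
        show (if k = g₀ then 2 + δ else if k = e' then 2 else if k ∈ Pv then 2 else 1) = 2
        rw [if_neg hkg₀, if_pos hke']
      rw [hq']; exact htwo
    by_cases hkP : k ∈ Pv
    · simp only [q, if_neg hkg₀, if_neg hke', if_pos hkP]; exact htwo
    · simp only [q, if_neg hkg₀, if_neg hke', if_neg hkP]
      -- `e`, or a tree edge with a shared AND slot (an `X`-private tree edge off `D e ∩ D e'` contradicts the touch lemma)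
      obtain ⟨s, hs2, k', hk', hne', hv⟩ : ∃ s : Fin 4, 2 ≤ s.val ∧ ∃ k' ∈ X, k' ≠ k ∧ I.vars k s ∈ varSet I k' := by
        by_cases hke : k = e
        · subst hke
          exact ⟨2, by decide, g₀, hg₀X, fun h => hg₀J (h ▸ heJ), hp_g₀⟩
        have hkU : k ∈ U := by
          rw [hXdef, mem_insert, mem_insert, mem_insert] at hk
          rcases hk with h | h | h | h
          · exact absurd h hkg₀
          · exact absurd h hke
          · exact absurd h hke'
          · exact h
        by_contra hno
        push Not at hno
        have hpriv : ∀ j' ∈ X, j' ≠ k → I.vars k 2 ∉ varSet I j' ∧ I.vars k 3 ∉ varSet I j' :=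
          fun j' hj' hnej => ⟨hno 2 (by decide) j' hj' hnej, hno 3 (by decide) j' hj' hnej⟩
        -- so `k` is `X`-private: off `u`, off the other cycle's AND variables
        have hgk : g₀ ≠ k := fun h => hg₀J (h ▸ hkJ)
        have hku2 : I.vars k 2 ≠ u := fun h => (hpriv g₀ hg₀X hgk).1 (h ▸ hu_g₀)
        have hku3 : I.vars k 3 ≠ u := fun h => (hpriv g₀ hg₀X hgk).2 (h ▸ hu_g₀)
        have hout : ∀ D ⊆ U, k ∉ D → I.vars k 2 ∉ D.biUnion (andPair I) ∧ I.vars k 3 ∉ D.biUnion (andPair I) := by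
          intro D hDU hkD
          constructor
          · intro h
            obtain ⟨j', hj', hv⟩ := mem_biUnion.1 h
            exact (hpriv j' (hUX (hDU hj')) (fun h' => hkD (h' ▸ hj'))).1 (andPair_subset_varSet I j' hv)
          · intro h
            obtain ⟨j', hj', hv⟩ := mem_biUnion.1 h
            exact (hpriv j' (hUX (hDU hj')) (fun h' => hkD (h' ▸ hj'))).2 (andPair_subset_varSet I j' hv)
        by_cases hkDe : k ∈ B.D e <;> by_cases hkDe' : k ∈ B.D e'
        · exact hkP (mem_filter.2 ⟨mem_inter.2 ⟨hkDe, hkDe'⟩, hpriv⟩)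
        · exact caseT_touch I hI hT hS hD hmvT he' hne hP hread hkDe hku2 hku3
            (hout _ subset_union_right hkDe').1 (hout _ subset_union_right hkDe').2
        · exact caseT_touch' I hI hT hS hD hmvT he' hne hP hread hkDe' hku2 hku3
            (hout _ subset_union_left hkDe).1 (hout _ subset_union_left hkDe).2
        · rcases mem_union.1 hkU with h | h
          · exact hkDe h
          · exact hkDe' h
      have h := card_varSet_inter_bdry_le I X k {0, 1, s} (fun s' hs' => by
        simp only [mem_insert, mem_singleton] at hs'
        rcases hs' with rfl | rfl | rfl
        · exact hxor k hk hkg₀ 0 (by decide)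
        · exact hxor k hk hkg₀ 1 (by decide)
        · exact not_mem_bdry_of_two I hk hk' (Ne.symm hne') (vars_mem_varSet I k s') hv)
      rw [card_three_slots hs2] at h
      exact h
  have hbd := card_bdry_le_sum I X q hq
  -- evaluate the sum
  have hPvU : Pv ⊆ U := fun j hj => by
    have h := (mem_inter.1 (mem_filter.1 hj).1)
    exact mem_union_left _ h.1
  have hqg₀ : q g₀ = 2 + δ := by
    show (if g₀ = g₀ then 2 + δ else if g₀ = e' then 2 else if g₀ ∈ Pv then 2 else 1) = 2 + δ
    rw [if_pos rfl]
  have hg₀e : e ≠ g₀ := fun h => hg₀J (h ▸ heJ)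
  have hg₀e' : e' ≠ g₀ := fun h => hg₀J (h ▸ he'J)
  have heP : e ∉ Pv := fun h => heU (hPvU h)
  have hqe : q e = 1 := by
    show (if e = g₀ then 2 + δ else if e = e' then 2 else if e ∈ Pv then 2 else 1) = 1
    rw [if_neg hg₀e, if_neg hee', if_neg heP]
  have hqe' : q e' = 2 := by
    show (if e' = g₀ then 2 + δ else if e' = e' then 2 else if e' ∈ Pv then 2 else 1) = 2
    rw [if_neg hg₀e', if_pos rfl]
  have hsumU : ∑ k ∈ U, q k = U.card + Pv.card := by
    have hsplit := (sum_filter_add_sum_filter_not U (fun k => k ∈ Pv) q).symm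
    have hf1 : U.filter (fun k => k ∈ Pv) = Pv := by
      ext k; simp only [mem_filter]; exact ⟨fun h => h.2, fun h => ⟨hPvU h, h⟩⟩
    rw [hsplit, hf1]
    have h1 : ∑ k ∈ Pv, q k = 2 * Pv.card := by
      rw [mul_comm, card_eq_sum_ones, sum_mul]
      refine sum_congr rfl fun k hk => ?_
      have hkU := hPvU hk
      have hkg₀ : k ≠ g₀ := fun h => hg₀J (h ▸ hUJ hkU)
      have hke' : k ≠ e' := fun h => he'U (h ▸ hkU)
      show (if k = g₀ then 2 + δ else if k = e' then 2 else if k ∈ Pv then 2 else 1) = 1 * 2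
      rw [if_neg hkg₀, if_neg hke', if_pos hk, one_mul]
    have h2 : ∑ k ∈ U.filter (fun k => k ∉ Pv), q k = (U.filter (fun k => k ∉ Pv)).card := by
      rw [card_eq_sum_ones]
      refine sum_congr rfl fun k hk => ?_
      obtain ⟨hkU, hkP⟩ := mem_filter.1 hk
      have hkg₀ : k ≠ g₀ := fun h => hg₀J (h ▸ hUJ hkU)
      have hke' : k ≠ e' := fun h => he'U (h ▸ hkU)
      show (if k = g₀ then 2 + δ else if k = e' then 2 else if k ∈ Pv then 2 else 1) = 1
      rw [if_neg hkg₀, if_neg hke', if_neg hkP]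
    rw [h1, h2]
    have hc := card_filter_add_card_filter_not (s := U) (fun k => k ∈ Pv)
    rw [hf1] at hc
    omega
  have hsumX : ∑ k ∈ X, q k = (2 + δ) + (1 + (2 + (U.card + Pv.card))) := by
    rw [hXdef, sum_insert hg₀X', sum_insert he'X', sum_insert he'U, hqg₀, hqe, hqe', hsumU]
  have hexp := hB X hXr
  rw [hXcard] at hexp
  rw [hsumX] at hbd
  have hδle : δ ≤ 1 := by rw [hδ]; split_ifs <;> omega
  refine ⟨fun hU => ?_, by omega⟩
  have hδ0 : δ = 0 := by rw [hδ, if_pos hU]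
  omega

/-- **The other chord is coupled** as soon as some edge of `D e ∪ D e'` passes through `u`, or `#(D e ∪ D e') ≥ 4`. -/
theorem caseT_pair_coupled (hbig : (∃ j ∈ B.D e ∪ B.D e', I.vars j 2 = u ∨ I.vars j 3 = u) ∨ 4 ≤ (B.D e ∪ B.D e').card) :
    ∀ x : Fin n → ZMod 2, x u = κ₀ + 1 → (sys I B).u e' x = (sys I B).u e x + 1 := by
  classical
  obtain ⟨-, hW, -, hd₁, -, -, -, -, hG, hg₀, hgv, -⟩ := id hD
  have he : e ∈ B.N := hG.1
  obtain ⟨Pv, hPv, hpriv, -, hwith, hwo⟩ := caseT_pair_budget I hI hT hS hB hD hmvT he' hne hP hread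
  -- `Pv` is non-empty
  have hne0 : Pv.Nonempty := by
    rw [nonempty_iff_ne_empty]
    intro h0
    rw [h0, card_empty, mul_zero, add_zero] at hwith hwo
    have heD : e ∉ B.D e := fun h => (mem_sdiff.1 (hW.hD e he h)).2 he
    have h2 : 2 ≤ (B.D e).card := PstarChordBridgeFundamental.two_le_card_of_even I hI hS heD (hW.hDeven e he)
    have h2U : 2 ≤ (B.D e ∪ B.D e').card := h2.trans (card_le_card subset_union_left)
    rcases hbig with hU | h4
    · have := hwith hU; omega
    · omega
  obtain ⟨π, hπ⟩ := hne0
  obtain ⟨hπDe, hπDe'⟩ := mem_inter.1 (hPv hπ)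
  have hπJ : π ∈ B.J₀ := (mem_sdiff.1 (hW.hD e he hπDe)).1
  have hg₀J : g₀ ∉ B.J₀ := fun h => disjoint_left.1 hd₁ hg₀ h
  have hu_g₀ : u ∈ varSet I g₀ := by
    rcases hgv with ⟨-, h3⟩ | ⟨h2, -⟩
    · exact h3 ▸ vars_mem_varSet I g₀ 3
    · exact h2 ▸ vars_mem_varSet I g₀ 2
  have hgπ := hpriv π hπ g₀ (mem_insert_self _ _) (fun h => hg₀J (h ▸ hπJ))
  have h2u : I.vars π 2 ≠ u := fun h => hgπ.1 (h ▸ hu_g₀)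
  have h3u : I.vars π 3 ≠ u := fun h => hgπ.2 (h ▸ hu_g₀)
  have hX : ∀ j ∈ B.D e ∪ B.D e', j ∈ insert g₀ (insert e (insert e' (B.D e ∪ B.D e'))) := fun j hj =>
    mem_insert_of_mem (mem_insert_of_mem (mem_insert_of_mem hj))
  have hpc : ∀ j ∈ B.D e, j ≠ π → I.vars π 2 ∉ andPair I j ∧ I.vars π 3 ∉ andPair I j := fun j hj hne' =>
    ⟨fun h => (hpriv π hπ j (hX j (mem_union_left _ hj)) hne').1 (andPair_subset_varSet I j h),
     fun h => (hpriv π hπ j (hX j (mem_union_left _ hj)) hne').2 (andPair_subset_varSet I j h)⟩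
  have hpc' : ∀ j ∈ B.D e', j ≠ π → I.vars π 2 ∉ andPair I j ∧ I.vars π 3 ∉ andPair I j := fun j hj hne' =>
    ⟨fun h => (hpriv π hπ j (hX j (mem_union_right _ hj)) hne').1 (andPair_subset_varSet I j h),
     fun h => (hpriv π hπ j (hX j (mem_union_right _ hj)) hne').2 (andPair_subset_varSet I j h)⟩
  exact coupled_of_private_shared I hI u (κ₀ + 1) (caseT_force I hI hT hD hmvT he' hne hP hread) hπDe hπDe' h2u h3u hpc hpc'

end Pair

end Summit.PneNP.PneNP.Theorems.PstarGateCaseTPair
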